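import Mathlib
import Summits.ResolutionOfSingularities.ResolutionOfSingularities.Theorems.RadicialJungCleanModelsCleanProp44NearLineScheme
import HarnessLib

/-!
# Route `RadicialJung`, crux `CleanModels` (stmt-ResolutionOfSingularities-15917), line `Sketch` rev 35, stub 6 `stub_cleanProp44` (X44c):
# CLEAN-PERMISSIBILITY OF NEAR LINES, XIV — the cross conditions for different pairs agree (one test per point)

Seat decomp-res-hand-2 g18 (structural hand).  The birth test ✓ `cleanPermissibleAt_nearLine_of_cross` / ✓ `cleanPermissibleAt_nearLine_or_corner_or_cross`
asks «`(τ♯ w_{k₁k₂}) = 𝔪_x 𝒪_{x'}`» for ALL pairs, `w_{k₁k₂} = a_{k₁} m_{k₂} c_{k₂} - a_{k₂} m_{k₁} c_{k₁}`.  In the uncharged case `p ∣ A = Σ a_k` these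
conditions AGREE along the near line of `y = Σ m_k c_k`, because of the identity `Σ_k w_{k k₂} = A · m_{k₂} c_{k₂} - a_{k₂} · y` (and `A = 0` in
characteristic `p`): in dimension `3` (indices `j, k₁, k₂`) `τ♯ w_{j k₂} = - τ♯ w_{k₁ k₂} - a_{k₂} e' y'` with `y' ∈ 𝔪_{x'}`.

* `sum_cross_eq` — the identity, in any commutative ring.
* `map_cross_add_map_cross_eq` — its image at a point of the near line for three indices exhausting `Fin n` (`n = 3`), `p ∣ A`.
* `cross_span_eq_iff` — hence `(τ♯ w_{j k₂}) = (e')` iff `(τ♯ w_{k₁ k₂}) = (e')` (`𝒪_{x'}` a local domain, `e' ≠ 0`): ONE cross test per point.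

Honest framing: OURS, elementary bookkeeping; a TOOL.  Nothing here proves X44c, any case of `CleanModels`, or resolution of singularities in
characteristic `p`.  Setting only: [cite: CossartPiltant2008, Lemma 4.3 (5)].
-/

noncomputable section

set_option linter.dupNamespace false -- mandated namespace of this single-conjunct summit

open IsLocalRing

namespace Summit.ResolutionOfSingularities.ResolutionOfSingularities.Theorems.RadicialJung.CleanModels

universe u

/-- **The cross identity** `Σ_k (a_k · m_{k₂} c_{k₂} - a_{k₂} · m_k c_k) = (Σ_k a_k) · m_{k₂} c_{k₂} - a_{k₂} · Σ_k m_k c_k`. [folklore] -/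
theorem sum_cross_eq {R : Type*} [CommRing R] {n : ℕ} (a : Fin n → ℕ) (m c : Fin n → R) (k₂ : Fin n) :
    ∑ k, ((a k : R) * (m k₂ * c k₂) - (a k₂ : R) * (m k * c k)) = ((∑ k, a k : ℕ) : R) * (m k₂ * c k₂) - (a k₂ : R) * ∑ k, m k * c k := by
  rw [Finset.sum_sub_distrib, ← Finset.sum_mul, Finset.mul_sum, Nat.cast_sum]

/-- **Two cross elements at a point of the near line differ by `a_{k₂} e' y'`** (indices `j ≠ k₁` and `k₂` exhausting `Fin n`, `p ∣ Σ a_k`,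
characteristic `p`, `φ(Σ m_k c_k) = e' y'`): `φ w_{j k₂} + φ w_{k₁ k₂} = - a_{k₂} · e' y'`. [cite: CossartPiltant2008, Lemma 4.3 (5)] -/
theorem map_cross_add_map_cross_eq {O O' : Type*} [CommRing O] [CommRing O'] (φ : O →+* O') (p : ℕ) [CharP O p] {n : ℕ}
    (a : Fin n → ℕ) (m c : Fin n → O) (hA : p ∣ ∑ k, a k) {j k₁ k₂ : Fin n} (hjk₁ : j ≠ k₁)
    (huniv : ∀ k, k = j ∨ k = k₁ ∨ k = k₂) {e' y' : O'} (hy : φ (∑ k, m k * c k) = e' * y') :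
    φ ((a j : O) * (m k₂ * c k₂) - (a k₂ : O) * (m j * c j)) + φ ((a k₁ : O) * (m k₂ * c k₂) - (a k₂ : O) * (m k₁ * c k₁)) =
      -((a k₂ : O') * (e' * y')) := by
  classical
  have hsum := sum_cross_eq (R := O) a m c k₂
  rw [Finset.sum_eq_add j k₁ hjk₁ (fun k _ hk => by
      rcases huniv k with h | h | h
      · exact absurd h hk.1
      · exact absurd h hk.2
      · rw [h]; ring) (fun h => absurd (Finset.mem_univ _) h) (fun h => absurd (Finset.mem_univ _) h)] at hsum
  have hA0 : ((∑ k, a k : ℕ) : O) = 0 := (CharP.cast_eq_zero_iff O p _).mpr hA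
  rw [hA0, zero_mul, zero_sub] at hsum
  rw [← map_add, hsum, map_neg, map_mul, map_natCast, hy]

/-- **One cross test per point**: under the hypotheses of `map_cross_add_map_cross_eq`, with `𝒪'` a local domain, `e' ≠ 0`, `y' ∈ 𝔪'` and both
cross elements divisible by `e'` (they lie in `𝔪_x 𝒪'`), `(φ w_{j k₂}) = (e')` iff `(φ w_{k₁ k₂}) = (e')`. [cite: CossartPiltant2008, Lemma 4.3 (5)] -/
theorem cross_span_eq_iff {O O' : Type u} [CommRing O] [CommRing O'] [IsLocalRing O'] [IsDomain O'] (φ : O →+* O') (p : ℕ) [CharP O p]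
    {n : ℕ} (a : Fin n → ℕ) (m c : Fin n → O) (hA : p ∣ ∑ k, a k) {j k₁ k₂ : Fin n} (hjk₁ : j ≠ k₁)
    (huniv : ∀ k, k = j ∨ k = k₁ ∨ k = k₂) {e' y' : O'} (he' : e' ≠ 0) (hy : φ (∑ k, m k * c k) = e' * y') (hy'm : y' ∈ maximalIdeal O')
    {r r₁ : O'} (hr : φ ((a j : O) * (m k₂ * c k₂) - (a k₂ : O) * (m j * c j)) = e' * r)
    (hr₁ : φ ((a k₁ : O) * (m k₂ * c k₂) - (a k₂ : O) * (m k₁ * c k₁)) = e' * r₁) :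
    Ideal.span {φ ((a j : O) * (m k₂ * c k₂) - (a k₂ : O) * (m j * c j))} = Ideal.span {e'} ↔
      Ideal.span {φ ((a k₁ : O) * (m k₂ * c k₂) - (a k₂ : O) * (m k₁ * c k₁))} = Ideal.span {e'} := by
  have hrel := map_cross_add_map_cross_eq φ p a m c hA hjk₁ huniv hy
  rw [hr, hr₁, ← mul_add] at hrel
  have hrr : r = -r₁ - (a k₂ : O') * y' := by
    have h1 : r + r₁ = -((a k₂ : O') * y') := mul_left_cancel₀ he' (by rw [hrel]; ring)
    linear_combination h1
  have hmem : (a k₂ : O') * y' ∈ maximalIdeal O' := Ideal.mul_mem_left _ _ hy'm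
  -- `(e' s) = (e')` iff `s` is a unit
  have key : ∀ s : O', Ideal.span {e' * s} = Ideal.span {e'} ↔ IsUnit s := fun s =>
    ⟨fun h => isUnit_of_span_singleton_mul_eq he' h, fun h => Ideal.span_singleton_mul_right_unit h e'⟩
  rw [hr, hr₁, key, key, hrr]
  constructor
  · intro h
    by_contra h₁
    have h2 : -r₁ - (a k₂ : O') * y' ∈ maximalIdeal O' :=
      (maximalIdeal O').sub_mem ((maximalIdeal O').neg_mem ((mem_maximalIdeal _).mpr h₁)) hmem
    exact mem_nonunits_iff.mp ((mem_maximalIdeal _).mp h2) h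
  · intro h
    by_contra h₁
    have h2 : -r₁ - (a k₂ : O') * y' ∈ maximalIdeal O' := (mem_maximalIdeal _).mpr h₁
    have h3 : r₁ ∈ maximalIdeal O' := by
      have h4 := (maximalIdeal O').add_mem h2 hmem
      rw [sub_add_cancel] at h4
      simpa using (maximalIdeal O').neg_mem h4
    exact mem_nonunits_iff.mp ((mem_maximalIdeal _).mp h3) h

end Summit.ResolutionOfSingularities.ResolutionOfSingularities.Theorems.RadicialJung.CleanModels

end
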